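import Mathlib
import HarnessLib
import Summits.NavierStokesRegularity.FluidComputer.TriggeredTransferWitness
import Summits.NavierStokesRegularity.FluidComputer.TriggeredTransferBounded
import Summits.NavierStokesRegularity.FluidComputer.ClayBreakdownWitnessBounded

/-!
# Fluid computer, door N1-FC — a cascade with CEILINGS is a BOUNDED witness: `TransfersB ν → NavierStokesBreakdownR3` with ZERO named facts

Cell `ns-blowup`, seat `ns-blowup-fc-prover-2` (D-0074 GROUP C «bridge support»). Assembles three
landed pieces: the cascade witness of seat `ns-blowup-fc-prover-1` (`TriggeredTransferWitness.lean`,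
p425084: `Run.toWitness`, velocity `limitVel = gvel (idx t) t`, `limitVel_eq_gvel`), this seat's
ceilings (`TriggeredTransferBounded.lean`, p425483: `StepB`, `TransfersB`, `Run.PiecesBounded`,
`exists_boundedRun`, `Run.gvel_norm_le`) and this seat's binder-free endpoint
(`ClayBreakdownWitnessBounded.lean`, p424892: `BreakdownWitness.navierStokesBreakdownR3_of_bounded`).
LABEL: E–C bookkeeping. WHAT THIS IS NOT: not Navier–Stokes evidence — an implication from the OPEN
predicate `TriggerScheme.TransfersB ν` (one-shot triggered transfers with a sup-ceiling on each piece,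
«η > 1/λ uniformly in Re»), asserted nowhere; no scheme instance claimed.

* `Run.boundedOnSlabs_toWitness : ρ.PiecesBounded → (ρ.toWitness hν).BoundedOnSlabs` — before any
  `T' < T*` only finitely many pieces are glued (`exists_lt_stop`, `limitVel_eq_gvel`, `gvel_norm_le`);
* `Run.navierStokesBreakdownR3_of_piecesBounded`, `exists_boundedWitness_of_transfersB`, and
  **`navierStokesBreakdownR3_of_transfersB : 0 < ν → 𝒮.TransfersB ν → NavierStokesBreakdownR3`**,
  **`navierStokesBreakdownR3_of_exists_transfersB : (∃ 𝒮, 𝒮.TransfersB 1) → NavierStokesBreakdownR3`**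
  — Fefferman's (C) from the bounded door crux with NO Literature hypothesis (compare
  `navierStokesBreakdownR3_of_transfers`, which needs W14 = `tao_unconditional_uniqueness_velocity_forced`).

So a TRIGGERED route typed over `TransfersB` is «one physical crux + theorems of the tree»: its
support cone is closed. [cite: Tao2016AveragedNS, §1.3] [cite: FeffermanClay2006, (C)]
0 sorry; axioms ⊆ {propext, Classical.choice, Quot.sound}.
-/

noncomputable section

namespace Summit.NavierStokesRegularity.FluidComputer.TriggeredTransfer.TriggerScheme

open Set MeasureTheory Function Filter
open scoped ENNReal ContDiff NNReal Topology
open Literature.Analysis.FluidPDE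
open Literature.Analysis.FluidPDE.FluidComputer (E3 Vel)
open Summit.NavierStokesRegularity.FluidComputer.PalasekTowerClayBridge

namespace Run

variable {𝒮 : TriggerScheme} {ν : ℝ} (ρ : 𝒮.Run ν)

/-- **A cascade with bounded pieces is a bounded witness**: for `T' < T*` some window end `stop N`
exceeds `T'` (`exists_lt_stop`), the witness velocity before `stop N` is the field glued through
level `N` (`limitVel_eq_gvel`), and that field is bounded (`gvel_norm_le`). [folklore] -/
theorem boundedOnSlabs_toWitness (hν : 0 < ν) (hB : ρ.PiecesBounded) :
    (ρ.toWitness hν).BoundedOnSlabs := by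
  intro T' hT'
  change T' < ρ.Tstar at hT'
  obtain ⟨N, hN⟩ := ρ.exists_lt_stop hν hT'
  obtain ⟨B, hb⟩ := ρ.gvel_norm_le hB N
  refine ⟨B, fun t ht x => ?_⟩
  have htN : t < ρ.stop N := lt_of_le_of_lt ht.2 hN
  change ‖ρ.limitVel hν t x‖ ≤ B
  rw [ρ.limitVel_eq_gvel hν htN]
  exact hb t ⟨ht.1, htN⟩ x

/-- **Fefferman's (C) from ONE run with bounded pieces at ONE viscosity — no named fact**
(`BreakdownWitness.navierStokesBreakdownR3_of_bounded` on `toWitness`). [cite: FeffermanClay2006, (C)] -/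
theorem navierStokesBreakdownR3_of_piecesBounded (hν : 0 < ν) (hB : ρ.PiecesBounded) :
    Summit.NavierStokesRegularity.NavierStokesRegularity.NavierStokesBreakdownR3 :=
  BreakdownWitness.navierStokesBreakdownR3_of_bounded hν (ρ.toWitness hν)
    (ρ.boundedOnSlabs_toWitness hν hB)

end Run

/-- **A scheme transferring with ceilings has a BOUNDED breakdown witness** (`exists_boundedRun` +
`Run.toWitness` + `Run.boundedOnSlabs_toWitness`). HONEST FRAMING: an implication from an open
predicate; no scheme is claimed to transfer. [cite: Tao2016AveragedNS, §1.3] -/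
theorem exists_boundedWitness_of_transfersB (𝒮 : TriggerScheme) {ν : ℝ} (hν : 0 < ν)
    (hT : 𝒮.TransfersB ν) : ∃ W : BreakdownWitness ν, W.BoundedOnSlabs := by
  obtain ⟨ρ, hB⟩ := 𝒮.exists_boundedRun hν hT
  exact ⟨ρ.toWitness hν, ρ.boundedOnSlabs_toWitness hν hB⟩

/-- **THE BOUNDED DOOR CLOSES ON (C) WITH ZERO NAMED FACTS.** If a one-shot triggered-transfer
scheme transfers WITH CEILINGS at some viscosity `ν > 0` — from every member of its alphabet at every
amplitude `U ≥ U⋆`, for every admissible seed, one exact classical triggered transfer on a compact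
slab, bounded there, with finite energy, handing over exactly to a `λ`-zoomed member at amplitude
`≥ (ηλ)^{1/2} U` — then Fefferman's breakdown statement (C) holds: the dependent-choice run glues to a
classical solution on `[0, T*)` from a Clay datum with a Clay force smooth through `T*`
(seat fc-prover-1), bounded on closed sub-slabs (this seat), locally unbounded as `t ↑ T*`; forced
Serrin–Masuda weak–strong uniqueness and Tao's forced pressure normalisation (THEOREMS of the tree,
PATH B′) exclude every global Clay competitor, and the viscosity scaling carries the witness to every
`ν`. Compare `navierStokesBreakdownR3_of_transfers` (no ceilings, but conditional on W14).
HONEST FRAMING: the hypothesis is the door's OPEN physics; nothing here asserts it.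
[cite: FeffermanClay2006, (C)] -/
theorem navierStokesBreakdownR3_of_transfersB (𝒮 : TriggerScheme) {ν : ℝ} (hν : 0 < ν)
    (hT : 𝒮.TransfersB ν) :
    Summit.NavierStokesRegularity.NavierStokesRegularity.NavierStokesBreakdownR3 := by
  obtain ⟨ρ, hB⟩ := 𝒮.exists_boundedRun hν hT
  exact ρ.navierStokesBreakdownR3_of_piecesBounded hν hB

/-- **The route's words**: the existence of a scheme transferring with ceilings at unit viscosity
implies `NavierStokesBreakdownR3` — ONE physical crux, NO Literature hypothesis.
[cite: FeffermanClay2006, (C)] -/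
theorem navierStokesBreakdownR3_of_exists_transfersB
    (h : ∃ 𝒮 : TriggerScheme, 𝒮.TransfersB 1) :
    Summit.NavierStokesRegularity.NavierStokesRegularity.NavierStokesBreakdownR3 := by
  obtain ⟨𝒮, hT⟩ := h
  exact 𝒮.navierStokesBreakdownR3_of_transfersB one_pos hT

/-- The Literature spelling of (C) from the bounded door. [cite: FeffermanClay2006, (C)] -/
theorem literature_navierStokesBreakdownR3_of_exists_transfersB
    (h : ∃ 𝒮 : TriggerScheme, 𝒮.TransfersB 1) : Literature.Analysis.FluidPDE.NavierStokesBreakdownR3 :=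
  navierStokesBreakdownR3_iff_literature.1 (navierStokesBreakdownR3_of_exists_transfersB h)

end Summit.NavierStokesRegularity.FluidComputer.TriggeredTransfer.TriggerScheme

end
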